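import Mathlib
import HarnessLib
import Literature.Analysis.FluidPDE.SwirlTransportProofs
import Summits.NavierStokesRegularity.NavierStokesRegularity.Theorems.PoloidalWindowRigidity.Negative.StuartVorticity
import Summits.NavierStokesRegularity.NavierStokesRegularity.Theorems.PoloidalWindowRigidity.Negative.GermOffFourStrata

/-!
# Crux K2 `PoloidalWindowRigidity` (stmt-NavierStokesRegularity-19708), skeleton lrc-jet v4 — negative side, brick 3/3:
# the research stub `stub_lrcGeneric` (LRC″ on the THICK stratum) is FALSE without the Oseen-mild identity

Negative-side support (refuter seat ns-regularity-refuter1, cell ns-regularity-ideate; D-0081 §C). The v4 skeleton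
`Cruxes/PoloidalWindowRigidity/Lines/lrc_jet.lean` of crux K2 splits LRC″ by the K2 lead's slope census: on the
(TH) stratum (slope a function of `(t, x₂)`) `stub_timeHeightShear`, on the thick stratum (slope a function of
`(t, x₂)` on NO open subset) the research stub `stub_lrcGeneric`: Type-I rate (R) + continuity (C) + Oseen-mild (M) +
divergence-free (D) + poloidal (P), a non-degenerate window with the thick pin ⟹ a slice and a window carrying a
translation germ or a vertical-rotation germ of the vorticity, or an unbounded entire germ of the slice.

`…Negative.TimeHeightShearFalseWithoutMild` showed that (M) is load-bearing on the (TH) stratum (shifted cellular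
profile). This file shows the same on the THICK stratum, with a witness that moreover has the frozen Clebsch structure
which (P) + (M) force in the class: the Stuart column of `…Negative.StuartColumn` / `…Negative.StuartVorticity`
(Kelvin–Stuart cat's eye `log W`, `W ΔW − |∇W|² = 3`, dressed poloidally; slope `Λ = −W²/6` varying across the vortex
lines). Certified here:
* `stuartProfile_no_translation_germ`, `stuartProfile_no_rotation_germ`, `stuartProfile_no_unbounded_entire_germ`:
  on no window of any slice `s < 0` does the vorticity `−(−s)^{-1/2} sin x₂ (W⁻¹ + 6W⁻³)(sin x₁, e^{x₀} − e^{−x₀}, 0)`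
  have a translation germ (evaluate the entire extension at `e₀` and `(π/2) e₂`) or a vertical-axis rotation germ
  (first component of the Killing defect at `(π/2) e₂` and `e₀ + (π/2) e₂`: `c₀ = 0`, then `e − e⁻¹ + 1 = 0`), and no
  slice agrees on a window with an entire field of unbounded norm (identity theorem + `‖v(s)‖ ≤ 6 (−s)^{-1/2}`);
* `lrcGeneric_false_without_mild`: the text of `stub_lrcGeneric` VERBATIM with hypothesis (M) deleted is FALSE
  (`C = 6`, window `stuartWindow`); `lrcGeneric_false_without_mild_frozen_analytic`: still false with (M) REPLACED by
  the frozen constraint (F) and real-analyticity of the slices (A) — these kinematic shadows of (M) do not close it.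
Reading for the K2 lead: LRC″ is not a kinematic fact on either stratum; on the thick stratum not even the frozen
structure + proportional shear with `∇ₕΛ ≠ 0` + Type-I rate + analyticity force a Killing symmetry of the vorticity —
every bit of `stub_lrcGeneric` is in the dynamics (M). (Structural remark: separable frozen thick fields correspond to
planar semilinear problems `Δₕ F = c·k(F)` with `k` non-linear; finitely many Laplace eigenmodes never give one —
two eigenmodes are functionally dependent only in the isoparametric, hence symmetric, case — which is why all earlier
witnesses of this lane had `Λ = Λ(t)` or `Λ = Λ(x₂)`; the Liouville equation is the first elementary source.)

WHAT THIS IS NOT: not a claim about Navier–Stokes regularity and not a refutation of any route declaration — a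
kernel-checked certificate that hypothesis (M) of the research stub cannot be dropped.
-/

noncomputable section

-- the summit and its single sub-problem share the name (CONVENTIONS §1), as in every Theorems file
set_option linter.dupNamespace false

namespace Summit.NavierStokesRegularity.NavierStokesRegularity.Theorems.PoloidalWindowRigidity.Negative

open MeasureTheory Set Function Filter Topology Metric
open scoped RealInnerProductSpace InnerProductSpace
open Literature.Analysis Literature.Analysis.FluidPDE

local notation "E3" => EuclideanSpace ℝ (Fin 3)
local notation "π" i => (EuclideanSpace.proj (𝕜 := ℝ) (i : Fin 3) : EuclideanSpace ℝ (Fin 3) →L[ℝ] ℝ)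
local notation "𝐞" i => (EuclideanSpace.single (i : Fin 3) (1 : ℝ) : EuclideanSpace ℝ (Fin 3))

/-! ## No window of any slice carries a Killing germ or an unbounded entire germ -/

/-- **No translation germ**: on no non-empty open set of any slice `s < 0` does a directional derivative of the
vorticity in a fixed non-zero direction vanish (evaluate the entire extension at `e₀` and `(π/2) e₂`). [folklore] -/
theorem stuartProfile_no_translation_germ {s : ℝ} (hs : s < 0) {U : Set E3} (hU : IsOpen U) (hne : U.Nonempty)
    {e : E3} (he : e ≠ 0) (h : ∀ y ∈ U, fderiv ℝ (curl (stuartProfile s)) y e = 0) : False := by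
  obtain ⟨y₀, hy₀⟩ := hne
  have hglob := eq_zero_of_eqOn_open (analyticOnNhd_fderiv_curl_stuartProfile_apply s e) hU hy₀ h
  have hc := cellAmp_pos hs
  have a0 : ((1 : ℝ) • (𝐞 0) : E3) 0 = 1 := by simp
  have a1 : ((1 : ℝ) • (𝐞 0) : E3) 1 = 0 := by simp
  have a2 : ((1 : ℝ) • (𝐞 0) : E3) 2 = 0 := by simp
  have b0 : ((Real.pi / 2) • (𝐞 2) : E3) 0 = 0 := by simp
  have b1 : ((Real.pi / 2) • (𝐞 2) : E3) 1 = 0 := by simp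
  have b2 : ((Real.pi / 2) • (𝐞 2) : E3) 2 = Real.pi / 2 := by simp
  have hPA := exp_sub_exp_neg_pos one_pos
  have hGA := stuartG_pos ((1 : ℝ) • (𝐞 0) : E3)
  have hGB := stuartG_pos ((Real.pi / 2) • (𝐞 2) : E3)
  -- at `y = e₀`, component 1: `−(−s)^{-1/2} P(1) G e₂ = 0`
  have h2 : e 2 = 0 := by
    have h0 : fderiv ℝ (curl (stuartProfile s)) ((1 : ℝ) • (𝐞 0)) e 1 = 0 := by rw [hglob _, PiLp.zero_apply]
    rw [fderiv_curl_stuartProfile_apply, stuartVortDeriv_apply_one, a0, a1, a2, Real.sin_zero, Real.cos_zero] at h0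
    have : cellAmp s * ((Real.exp 1 - Real.exp (-1)) *
        ((stuartW ((1 : ℝ) • (𝐞 0) : E3))⁻¹ + 6 * (stuartW ((1 : ℝ) • (𝐞 0) : E3))⁻¹ ^ 3)) * e 2 = 0 := by
      linear_combination -h0
    rcases mul_eq_zero.1 this with h' | h'
    · exact absurd h' (mul_pos hc (mul_pos hPA hGA)).ne'
    · exact h'
  -- at `y = (π/2) e₂`, component 0: `−(−s)^{-1/2} G e₁ = 0`
  have h1 : e 1 = 0 := by
    have h0 : fderiv ℝ (curl (stuartProfile s)) ((Real.pi / 2) • (𝐞 2)) e 0 = 0 := by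
      rw [hglob _, PiLp.zero_apply]
    rw [fderiv_curl_stuartProfile_apply, stuartVortDeriv_apply_zero, b0, b1, b2, Real.sin_pi_div_two,
      Real.cos_pi_div_two, Real.sin_zero, Real.cos_zero] at h0
    have : cellAmp s * ((stuartW ((Real.pi / 2) • (𝐞 2) : E3))⁻¹ +
        6 * (stuartW ((Real.pi / 2) • (𝐞 2) : E3))⁻¹ ^ 3) * e 1 = 0 := by
      linear_combination -h0
    rcases mul_eq_zero.1 this with h' | h'
    · exact absurd h' (mul_pos hc hGB).ne'
    · exact h'
  -- at `y = (π/2) e₂`, component 1: `−2 (−s)^{-1/2} G e₀ = 0`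
  have h0' : e 0 = 0 := by
    have h0 : fderiv ℝ (curl (stuartProfile s)) ((Real.pi / 2) • (𝐞 2)) e 1 = 0 := by
      rw [hglob _, PiLp.zero_apply]
    rw [fderiv_curl_stuartProfile_apply, stuartVortDeriv_apply_one, b0, b1, b2, Real.sin_pi_div_two,
      Real.cos_pi_div_two, Real.sin_zero, neg_zero, Real.exp_zero, h1] at h0
    have : cellAmp s * ((stuartW ((Real.pi / 2) • (𝐞 2) : E3))⁻¹ +
        6 * (stuartW ((Real.pi / 2) • (𝐞 2) : E3))⁻¹ ^ 3) * (2 * e 0) = 0 := by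
      linear_combination -h0
    rcases mul_eq_zero.1 this with h' | h'
    · exact absurd h' (mul_pos hc hGB).ne'
    · linarith
  apply he
  ext i
  fin_cases i
  · simpa using h0'
  · simpa using h1
  · simpa using h2

/-- `J a = −a₁ e₀ + a₀ e₁` (the library's `rotGen_eq_sub_single`, rearranged into the `smul`-sum form that
`map_add`/`map_smul` consume below). [folklore] -/
theorem rotGen_eq_smul (a : E3) : rotGen a = (-(a 1)) • (𝐞 0) + (a 0) • (𝐞 1) := by
  ext i
  fin_cases i <;> simp

/-- **No rotation germ about a vertical axis**: on no non-empty open set of any slice `s < 0` does the vorticity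
satisfy the infinitesimal Killing equation `J curl v(s)(y) = D(curl v(s))(y) J(y − c)` of the rotations about the
vertical axis through `c` (first component of the entire defect at `(π/2) e₂` gives `c₀ = 0`, at `e₀ + (π/2) e₂`
then `e − e⁻¹ + 1 = 0`). [folklore] -/
theorem stuartProfile_no_rotation_germ {s : ℝ} (hs : s < 0) {U : Set E3} (hU : IsOpen U) (hne : U.Nonempty)
    (c : E3) (h : ∀ y ∈ U, rotGen (curl (stuartProfile s) y) = fderiv ℝ (curl (stuartProfile s)) y (rotGen (y - c))) :
    False := by
  obtain ⟨y₀, hy₀⟩ := hne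
  have hc := cellAmp_pos hs
  -- the first component of the Killing defect: an entire function
  set φ : E3 → ℝ := fun y => -(curl (stuartProfile s) y 1) +
    ((y 1 - c 1) * fderiv ℝ (curl (stuartProfile s)) y (𝐞 0) 0 -
      (y 0 - c 0) * fderiv ℝ (curl (stuartProfile s)) y (𝐞 1) 0) with hφ
  have hφa : AnalyticOnNhd ℝ φ univ := by
    intro y _
    have hY : ∀ k : Fin 3, AnalyticAt ℝ (fun y : E3 => y k) y := fun k => (π k).analyticAt y
    have hc1 : AnalyticAt ℝ (fun y => curl (stuartProfile s) y 1) y :=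
      (π 1).analyticAt _ |>.comp (analyticOnNhd_curl_stuartProfile s y trivial)
    have hd0 : AnalyticAt ℝ (fun y => fderiv ℝ (curl (stuartProfile s)) y (𝐞 0) 0) y :=
      (π 0).analyticAt _ |>.comp (analyticOnNhd_fderiv_curl_stuartProfile_apply s (𝐞 0) y trivial)
    have hd1 : AnalyticAt ℝ (fun y => fderiv ℝ (curl (stuartProfile s)) y (𝐞 1) 0) y :=
      (π 0).analyticAt _ |>.comp (analyticOnNhd_fderiv_curl_stuartProfile_apply s (𝐞 1) y trivial)
    exact hc1.neg.add ((((hY 1).sub analyticAt_const).mul hd0).sub (((hY 0).sub analyticAt_const).mul hd1))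
  have hφU : ∀ y ∈ U, φ y = 0 := fun y hy => by
    have hy' := congrArg (fun w : E3 => w 0) (h y hy)
    dsimp only at hy'
    rw [rotGen_apply_zero, rotGen_eq_smul, map_add, map_smul, map_smul, PiLp.add_apply, PiLp.smul_apply,
      PiLp.smul_apply, smul_eq_mul, smul_eq_mul, PiLp.sub_apply, PiLp.sub_apply] at hy'
    rw [hφ]
    dsimp only
    linear_combination hy'
  have hglob := eq_zero_of_eqOn_open hφa hU hy₀ hφU
  have b0 : ((Real.pi / 2) • (𝐞 2) : E3) 0 = 0 := by simp
  have b1 : ((Real.pi / 2) • (𝐞 2) : E3) 1 = 0 := by simp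
  have b2 : ((Real.pi / 2) • (𝐞 2) : E3) 2 = Real.pi / 2 := by simp
  have d0 : ((1 : ℝ) • (𝐞 0) + (Real.pi / 2) • (𝐞 2) : E3) 0 = 1 := by simp
  have d1 : ((1 : ℝ) • (𝐞 0) + (Real.pi / 2) • (𝐞 2) : E3) 1 = 0 := by simp
  have d2 : ((1 : ℝ) • (𝐞 0) + (Real.pi / 2) • (𝐞 2) : E3) 2 = Real.pi / 2 := by simp
  have s00 : (𝐞 0 : E3) 0 = 1 := by simp
  have s01 : (𝐞 0 : E3) 1 = 0 := by simp
  have s02 : (𝐞 0 : E3) 2 = 0 := by simp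
  have s10 : (𝐞 1 : E3) 0 = 0 := by simp
  have s11 : (𝐞 1 : E3) 1 = 1 := by simp
  have s12 : (𝐞 1 : E3) 2 = 0 := by simp
  have hGB := stuartG_pos ((Real.pi / 2) • (𝐞 2) : E3)
  have hGD := stuartG_pos ((1 : ℝ) • (𝐞 0) + (Real.pi / 2) • (𝐞 2) : E3)
  have hPD := exp_sub_exp_neg_pos one_pos
  -- at `(π/2) e₂`: `c₀ (−s)^{-1/2} G = 0`
  have hc0 : c 0 = 0 := by
    have h0 := hglob ((Real.pi / 2) • (𝐞 2))
    rw [hφ] at h0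
    dsimp only at h0
    rw [curl_stuartProfile_apply_one, fderiv_curl_stuartProfile_apply s _ (𝐞 0) 0,
      fderiv_curl_stuartProfile_apply s _ (𝐞 1) 0, stuartVortDeriv_apply_zero, stuartVortDeriv_apply_zero,
      s00, s01, s02, s10, s11, s12, b0, b1, b2, Real.sin_pi_div_two, Real.cos_pi_div_two, Real.sin_zero,
      Real.cos_zero, neg_zero, Real.exp_zero] at h0
    have : cellAmp s * ((stuartW ((Real.pi / 2) • (𝐞 2) : E3))⁻¹ +
        6 * (stuartW ((Real.pi / 2) • (𝐞 2) : E3))⁻¹ ^ 3) * c 0 = 0 := by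
      linear_combination -h0
    rcases mul_eq_zero.1 this with h' | h'
    · exact absurd h' (mul_pos hc hGB).ne'
    · exact h'
  -- at `e₀ + (π/2) e₂`: `(−s)^{-1/2} G (e − e⁻¹ + 1 − c₀) = 0`
  have hD := hglob ((1 : ℝ) • (𝐞 0) + (Real.pi / 2) • (𝐞 2))
  rw [hφ] at hD
  dsimp only at hD
  rw [curl_stuartProfile_apply_one, fderiv_curl_stuartProfile_apply s _ (𝐞 0) 0,
    fderiv_curl_stuartProfile_apply s _ (𝐞 1) 0, stuartVortDeriv_apply_zero, stuartVortDeriv_apply_zero,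
    s00, s01, s02, s10, s11, s12, d0, d1, d2, Real.sin_pi_div_two, Real.cos_pi_div_two, Real.sin_zero,
    Real.cos_zero, hc0] at hD
  have : cellAmp s * ((stuartW ((1 : ℝ) • (𝐞 0) + (Real.pi / 2) • (𝐞 2) : E3))⁻¹ +
      6 * (stuartW ((1 : ℝ) • (𝐞 0) + (Real.pi / 2) • (𝐞 2) : E3))⁻¹ ^ 3) *
      (Real.exp 1 - Real.exp (-1) + 1) = 0 := by
    linear_combination hD
  have hpos : 0 < cellAmp s * ((stuartW ((1 : ℝ) • (𝐞 0) + (Real.pi / 2) • (𝐞 2) : E3))⁻¹ +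
      6 * (stuartW ((1 : ℝ) • (𝐞 0) + (Real.pi / 2) • (𝐞 2) : E3))⁻¹ ^ 3) *
      (Real.exp 1 - Real.exp (-1) + 1) := mul_pos (mul_pos hc hGD) (by linarith)
  linarith

/-- **No unbounded entire germ**: an entire real-analytic field agreeing with a slice of the witness on a non-empty
open set is the slice itself, hence bounded (`‖v(s)‖ ≤ 6 (−s)^{-1/2}`). [folklore] -/
theorem stuartProfile_no_unbounded_entire_germ (s : ℝ) {U : Set E3} (hU : IsOpen U) (hne : U.Nonempty)
    {w : E3 → E3} (hw : AnalyticOnNhd ℝ w univ) (hwU : ∀ y ∈ U, stuartProfile s y = w y) :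
    BddAbove (Set.range fun y => ‖w y‖) := by
  obtain ⟨y₀, hy₀⟩ := hne
  have hglob := eq_zero_of_eqOn_open (hw.sub (analyticOnNhd_stuartProfile s)) hU hy₀
    (fun y hy => by simp [hwU y hy])
  refine ⟨cellAmp s * 6, ?_⟩
  rintro _ ⟨y, rfl⟩
  have hy : w y = stuartProfile s y := by
    have h := hglob y
    simp only [Pi.sub_apply, sub_eq_zero] at h
    exact h
  show ‖w y‖ ≤ cellAmp s * 6
  rw [hy]
  exact norm_stuartProfile_le s y

/-! ## The thick-stratum stub minus the Oseen-mild identity is false -/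

/-- **`stub_lrcGeneric` (skeleton lrc-jet v4 of crux K2) without the Oseen-mild identity is FALSE.** The negated
statement is the text of `Summit.NavierStokesRegularity.NavierStokesRegularity.Theses.PoloidalWindowDoor.stub_lrcGeneric`
(`Cruxes/PoloidalWindowRigidity/Lines/lrc_jet.lean`, v4) VERBATIM with its third hypothesis (the unit-viscosity
Oseen-mild identity) deleted. Witness: the Stuart column `(−t)^{-1/2} V` (`C = 6`) on the window
`{t < 0} × {x₀ > 0, 0 < x₂ < π}`: (R), (C), (D), (P) (and the frozen constraint) hold, the three pins hold, the shear
slope `−W(x₀,x₁)²/6` is a function of `(t, x₂)` on NO open subset, and no slice has a vorticity translation germ, a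
vertical-axis rotation germ, or an unbounded entire germ on any window. So (M) is load-bearing for the thick-stratum
stub too — and EVEN GRANTED the frozen Clebsch structure that (P) + (M) produce: LRC″ is nowhere a kinematic fact.
[folklore] -/
theorem lrcGeneric_false_without_mild :
    ¬ (∀ (C : ℝ) (v : ℝ → EuclideanSpace ℝ (Fin 3) → EuclideanSpace ℝ (Fin 3)),
      Literature.Analysis.FluidPDE.HasTypeITimeDecay C v →
      ContinuousOn (Function.uncurry v) (Set.Iio (0 : ℝ) ×ˢ Set.univ) →
      (∀ t < 0, Literature.Analysis.FluidPDE.VectorCalculus.IsDivFree (v t)) →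
      (∀ s < 0, ∀ y, ⟪Literature.Analysis.FluidPDE.curl (v s) y, EuclideanSpace.single 2 1⟫_ℝ = 0) →
      ∀ W : Set (ℝ × EuclideanSpace ℝ (Fin 3)), IsOpen W → W.Nonempty → W ⊆ Set.Iio (0 : ℝ) ×ˢ Set.univ →
        (∀ z ∈ W, Literature.Analysis.FluidPDE.curl (v z.1) z.2 ≠ 0 ∧
          (fderiv ℝ (v z.1) z.2 (EuclideanSpace.single 0 1) 2 ≠ 0 ∨ fderiv ℝ (v z.1) z.2 (EuclideanSpace.single 1 1) 2 ≠ 0) ∧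
          (fderiv ℝ (v z.1) z.2 (EuclideanSpace.single 2 1) 0 ≠ 0 ∨ fderiv ℝ (v z.1) z.2 (EuclideanSpace.single 2 1) 1 ≠ 0)) →
        (∀ m : ℝ → ℝ → ℝ, ∀ W₁ : Set (ℝ × EuclideanSpace ℝ (Fin 3)), W₁ ⊆ W → IsOpen W₁ → W₁.Nonempty →
          ∃ z ∈ W₁, ∃ b : Fin 3, b ≠ 2 ∧
            fderiv ℝ (v z.1) z.2 (EuclideanSpace.single 2 1) b ≠
              m z.1 (z.2 2) * fderiv ℝ (v z.1) z.2 (EuclideanSpace.single b 1) 2) →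
        ∃ s : ℝ, s < 0 ∧ ∃ U : Set (EuclideanSpace ℝ (Fin 3)), IsOpen U ∧ U.Nonempty ∧
          ((∃ e : EuclideanSpace ℝ (Fin 3), e ≠ 0 ∧ ∀ y ∈ U, fderiv ℝ (Literature.Analysis.FluidPDE.curl (v s)) y e = 0) ∨
           (∃ c : EuclideanSpace ℝ (Fin 3), ∀ y ∈ U,
              Literature.Analysis.FluidPDE.rotGen (Literature.Analysis.FluidPDE.curl (v s) y) =
                fderiv ℝ (Literature.Analysis.FluidPDE.curl (v s)) y (Literature.Analysis.FluidPDE.rotGen (y - c))) ∨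
           (∃ w : EuclideanSpace ℝ (Fin 3) → EuclideanSpace ℝ (Fin 3), AnalyticOnNhd ℝ w Set.univ ∧
              ¬ BddAbove (Set.range fun y => ‖w y‖) ∧ ∀ y ∈ U, v s y = w y))) := by
  intro H
  obtain ⟨s, hs, U, hU, hne, halt⟩ := H 6 stuartProfile hasTypeITimeDecay_stuartProfile continuousOn_stuartProfile
    (fun t _ => isDivFree_stuartProfile t) (fun s _ y => poloidal_stuartProfile s y) stuartWindow isOpen_stuartWindow
    stuartWindow_nonempty stuartWindow_subset stuartProfile_pins
    (fun m W₁ hW₁ hW₁o hW₁n => stuartProfile_slope_not_timeHeight m W₁ hW₁ hW₁o hW₁n)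
  rcases halt with ⟨e, he, htr⟩ | ⟨c, hrot⟩ | ⟨w, hw, hunb, hwU⟩
  · exact stuartProfile_no_translation_germ hs hU hne he htr
  · exact stuartProfile_no_rotation_germ hs hU hne c hrot
  · exact hunb (stuartProfile_no_unbounded_entire_germ s hU hne hw hwU)

/-- **The same, EVEN GRANTED the frozen Clebsch structure and real-analytic slices.**  The text of `stub_lrcGeneric`
with (M) deleted and two hypotheses ADDED in its place — (F) the frozen constraint `⟪Dv(s)(y)·curl v(s)(y), e₂⟫ = 0`
(which (P) + (M) produce in the class) and (A) real-analyticity of every slice on `ℝ³` (which (M) produces in the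
class) — is still FALSE: the Stuart column satisfies both (`frozen_stuartProfile`, `analyticOnNhd_stuartProfile`).  So
no KINEMATIC consequence of (M) of this kind closes the thick stratum; the stub's content is genuinely dynamical.
[folklore] -/
theorem lrcGeneric_false_without_mild_frozen_analytic :
    ¬ (∀ (C : ℝ) (v : ℝ → EuclideanSpace ℝ (Fin 3) → EuclideanSpace ℝ (Fin 3)),
      Literature.Analysis.FluidPDE.HasTypeITimeDecay C v →
      ContinuousOn (Function.uncurry v) (Set.Iio (0 : ℝ) ×ˢ Set.univ) →
      (∀ t < 0, Literature.Analysis.FluidPDE.VectorCalculus.IsDivFree (v t)) →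
      (∀ s < 0, ∀ y, ⟪Literature.Analysis.FluidPDE.curl (v s) y, EuclideanSpace.single 2 1⟫_ℝ = 0) →
      (∀ s < 0, ∀ y, ⟪fderiv ℝ (v s) y (Literature.Analysis.FluidPDE.curl (v s) y), EuclideanSpace.single 2 1⟫_ℝ = 0) →
      (∀ s < 0, AnalyticOnNhd ℝ (v s) Set.univ) →
      ∀ W : Set (ℝ × EuclideanSpace ℝ (Fin 3)), IsOpen W → W.Nonempty → W ⊆ Set.Iio (0 : ℝ) ×ˢ Set.univ →
        (∀ z ∈ W, Literature.Analysis.FluidPDE.curl (v z.1) z.2 ≠ 0 ∧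
          (fderiv ℝ (v z.1) z.2 (EuclideanSpace.single 0 1) 2 ≠ 0 ∨ fderiv ℝ (v z.1) z.2 (EuclideanSpace.single 1 1) 2 ≠ 0) ∧
          (fderiv ℝ (v z.1) z.2 (EuclideanSpace.single 2 1) 0 ≠ 0 ∨ fderiv ℝ (v z.1) z.2 (EuclideanSpace.single 2 1) 1 ≠ 0)) →
        (∀ m : ℝ → ℝ → ℝ, ∀ W₁ : Set (ℝ × EuclideanSpace ℝ (Fin 3)), W₁ ⊆ W → IsOpen W₁ → W₁.Nonempty →
          ∃ z ∈ W₁, ∃ b : Fin 3, b ≠ 2 ∧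
            fderiv ℝ (v z.1) z.2 (EuclideanSpace.single 2 1) b ≠
              m z.1 (z.2 2) * fderiv ℝ (v z.1) z.2 (EuclideanSpace.single b 1) 2) →
        ∃ s : ℝ, s < 0 ∧ ∃ U : Set (EuclideanSpace ℝ (Fin 3)), IsOpen U ∧ U.Nonempty ∧
          ((∃ e : EuclideanSpace ℝ (Fin 3), e ≠ 0 ∧ ∀ y ∈ U, fderiv ℝ (Literature.Analysis.FluidPDE.curl (v s)) y e = 0) ∨
           (∃ c : EuclideanSpace ℝ (Fin 3), ∀ y ∈ U,
              Literature.Analysis.FluidPDE.rotGen (Literature.Analysis.FluidPDE.curl (v s) y) =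
                fderiv ℝ (Literature.Analysis.FluidPDE.curl (v s)) y (Literature.Analysis.FluidPDE.rotGen (y - c))) ∨
           (∃ w : EuclideanSpace ℝ (Fin 3) → EuclideanSpace ℝ (Fin 3), AnalyticOnNhd ℝ w Set.univ ∧
              ¬ BddAbove (Set.range fun y => ‖w y‖) ∧ ∀ y ∈ U, v s y = w y))) := by
  intro H
  obtain ⟨s, hs, U, hU, hne, halt⟩ := H 6 stuartProfile hasTypeITimeDecay_stuartProfile continuousOn_stuartProfile
    (fun t _ => isDivFree_stuartProfile t) (fun s _ y => poloidal_stuartProfile s y)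
    (fun s _ y => frozen_stuartProfile s y) (fun s _ => analyticOnNhd_stuartProfile s) stuartWindow
    isOpen_stuartWindow stuartWindow_nonempty stuartWindow_subset stuartProfile_pins
    (fun m W₁ hW₁ hW₁o hW₁n => stuartProfile_slope_not_timeHeight m W₁ hW₁ hW₁o hW₁n)
  rcases halt with ⟨e, he, htr⟩ | ⟨c, hrot⟩ | ⟨w, hw, hunb, hwU⟩
  · exact stuartProfile_no_translation_germ hs hU hne he htr
  · exact stuartProfile_no_rotation_germ hs hU hne c hrot
  · exact hunb (stuartProfile_no_unbounded_entire_germ s hU hne hw hwU)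

end Summit.NavierStokesRegularity.NavierStokesRegularity.Theorems.PoloidalWindowRigidity.Negative

end
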